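import Literature.Algebra.EuclideanLattices.LLLProofs
import Literature.Algebra.EuclideanLattices.IntegerBases
import HarnessLib

/-!
# Regev 2004, Lemma 3.3: coefficients of a shortest vector in an LLL-reduced basis

Topic `Algebra/EuclideanLattices` (family `pqc`). O. Regev, *Quantum computation and lattice
problems*, SIAM J. Comput. 33 (2004), §3.2, Lemma 3.3 (pp. 6–7): if `b₁, …, bₙ` is an LLL-reduced
basis (`‖b*ᵢ‖ ≤ √2 ‖b*ᵢ₊₁‖`, `|μᵢⱼ| ≤ 1/2`, i.e. LLL82 (1.4)–(1.5) with `δ = 3/4`) and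
`ū = ∑ uᵢ bᵢ` is a shortest nonzero vector of the lattice, then `|uᵢ| ≤ 2^{2n}` for all `i`. This
is the ingredient of Regev's Claims 3.6 / 3.14 guaranteeing that the shifted coefficient vector
`ā' = ā ± u'` stays inside the box `{0, …, M-1}ⁿ`; it is proved material towards the named fact
`Literature.Algebra.EuclideanLattices.usvp_of_dihedralCoset` (Regev's Thm. 1.1). Everything here
is PROVED (no named fact):

* `Regev2004.abs_coeff_le_two_pow_sq` — **Lemma 3.3** for an abstract LLL-reduced, linearly
  independent family in a real inner product space, under the (weaker than printed) hypothesis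
  `‖ū‖ ≤ ‖b₀‖` (a shortest vector is in particular not longer than the basis vector `b₀`);
* `Regev2004.abs_coeff_le_of_norm_eq_minNorm` — the lemma as printed, for the rows of a nonsingular
  integer basis matrix (`LatticeInstance`) and the coefficient vector of a shortest nonzero vector.

The tree's LLL82 facts used (all discharged in `LLLProofs.lean`): `sq_norm_zero_le_two_pow_mul`
(`‖b₀‖² ≤ 2^i ‖b*ᵢ‖²`, LLL82 (1.7)), `gsCoeff_mul_sq_norm`, `inner_self_gramSchmidt`; and
Mathlib's `gramSchmidt_inv_triangular`, `gramSchmidt_ne_zero`.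

## Proof (as printed, p. 7, with indices from `0` and the downward induction run on suffix sums)

The `i`-th Gram–Schmidt coordinate of `ū` is `(uᵢ ‖b*ᵢ‖² + ∑_{j>i} uⱼ ⟪bⱼ, b*ᵢ⟫)/‖b*ᵢ‖` (the
terms `j < i` vanish) and is at most `‖ū‖ ≤ ‖b₀‖ ≤ 2^{i/2} ‖b*ᵢ‖ ≤ 2ⁿ ‖b*ᵢ‖` in absolute value;
with `|⟪bⱼ, b*ᵢ⟫| ≤ ½ ‖b*ᵢ‖²` this gives the key inequality `|uᵢ| ≤ 2ⁿ + ½ ∑_{j>i} |uⱼ|`. The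
suffix sums `Rᵢ = ∑_{j ≥ i} |uⱼ|` then satisfy `Rₙ = 0` and `Rᵢ ≤ 2ⁿ + (3/2) Rᵢ₊₁`, whence
`Rᵢ ≤ 2^{2n-i} - 2ⁿ` by downward induction, and `|uᵢ| ≤ Rᵢ ≤ 2^{2n}` (Regev's induction bounds
`|u_k| ≤ 2^{2n-k}` directly, indices from `1`).

## References

* O. Regev, *Quantum computation and lattice problems*, SIAM J. Comput. 33 (2004), Lemma 3.3.
* A. K. Lenstra, H. W. Lenstra Jr., L. Lovász, Math. Ann. 261 (1982), (1.2), (1.4), (1.7).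
-/

noncomputable section

open Finset Module InnerProductSpace
open scoped RealInnerProductSpace

namespace Literature.Algebra.EuclideanLattices

section Abstract

variable {E : Type*} [NormedAddCommGroup E] [InnerProductSpace ℝ E] {n : ℕ}

/-- Size reduction as a bound on inner products: `|⟪bⱼ, b*ᵢ⟫| ≤ ½ ‖b*ᵢ‖²` for `i < j`
(LLL82 (1.4), `|μⱼᵢ| ≤ 1/2`, multiplied by `‖b*ᵢ‖²`). [cite: LenstraLenstraLovasz1982, (1.4)] -/
theorem abs_inner_gramSchmidt_le_half_sq_norm {b : Fin n → E} (h : IsLLLReduced (3 / 4) b)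
    {i j : Fin n} (hij : i < j) :
    |⟪b j, gramSchmidt ℝ b i⟫_ℝ| ≤ 1 / 2 * ‖gramSchmidt ℝ b i‖ ^ 2 := by
  rw [← gsCoeff_mul_sq_norm, abs_mul, abs_of_nonneg (sq_nonneg ‖gramSchmidt ℝ b i‖)]
  exact mul_le_mul_of_nonneg_right (h.1 j i hij) (sq_nonneg _)

/-- For an LLL-reduced family (`δ = 3/4`), `‖b₀‖ ≤ 2ⁿ ‖b*ᵢ‖` for every `i` (a crude form of
LLL82 (1.7), `‖b₀‖² ≤ 2^i ‖b*ᵢ‖²`, as in Regev's "`‖b*ᵢ‖ ≥ 2^{-(i-1)/2} ‖b*₁‖ ≥ 2^{-n} ‖ū‖`").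
[cite: Regev2004, proof of Lemma 3.3 (p. 7)] -/
theorem norm_zero_le_two_pow_mul_norm_gramSchmidt {b : Fin n → E} (h : IsLLLReduced (3 / 4) b)
    (hn : 0 < n) (i : Fin n) :
    ‖b ⟨0, hn⟩‖ ≤ 2 ^ n * ‖gramSchmidt ℝ b i‖ := by
  have h1 : ‖b ⟨0, hn⟩‖ ^ 2 ≤ 2 ^ (i : ℕ) * ‖gramSchmidt ℝ b i‖ ^ 2 :=
    IsLLLReduced.sq_norm_zero_le_two_pow_mul_holds h i hn
  have h2 : (2 : ℝ) ^ (i : ℕ) ≤ (2 ^ n) ^ 2 := by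
    rw [← pow_mul]
    exact pow_le_pow_right₀ (by norm_num) (by omega)
  have h3 : ‖b ⟨0, hn⟩‖ ^ 2 ≤ (2 ^ n * ‖gramSchmidt ℝ b i‖) ^ 2 := by
    rw [mul_pow]
    exact h1.trans (mul_le_mul_of_nonneg_right h2 (sq_nonneg _))
  exact (pow_le_pow_iff_left₀ (norm_nonneg _) (by positivity) two_ne_zero).1 h3

/-- **Regev 2004, Lemma 3.3** (abstract form). Let `b₀, …, bₙ₋₁` be linearly independent and
LLL-reduced with `δ = 3/4` in a real inner product space, and let `ū = ∑ⱼ uⱼ bⱼ` (`u ∈ ℤⁿ`)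
satisfy `‖ū‖ ≤ ‖b₀‖` — in particular any shortest nonzero vector of the lattice `∑ ℤ bⱼ`. Then
`|uᵢ| ≤ 2^{2n}` for every `i`. [cite: Regev2004, Lemma 3.3] -/
theorem Regev2004.abs_coeff_le_two_pow_sq {b : Fin n → E} (hb : LinearIndependent ℝ b)
    (h : IsLLLReduced (3 / 4) b) (hn : 0 < n) (u : Fin n → ℤ)
    (hu : ‖∑ j, (u j : ℝ) • b j‖ ≤ ‖b ⟨0, hn⟩‖) (i : Fin n) :
    |(u i : ℝ)| ≤ 2 ^ (2 * n) := by
  -- `a j = |uⱼ|` extended by `0` to all of `ℕ`, and the suffix sums `R m = ∑_{m ≤ j < n} |uⱼ|`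
  set a : ℕ → ℝ := fun j => if hj : j < n then |(u ⟨j, hj⟩ : ℝ)| else 0 with ha
  set R : ℕ → ℝ := fun m => ∑ j ∈ Ico m n, a j with hR
  have ha0 : ∀ j, 0 ≤ a j := fun j => by
    simp only [ha]
    split_ifs
    · exact abs_nonneg _
    · exact le_rfl
  have hR0 : ∀ m, 0 ≤ R m := fun m => sum_nonneg fun j _ => ha0 j
  have hRn : R n = 0 := by simp [hR]
  have hRsucc : ∀ k, k < n → R k = a k + R (k + 1) := fun k hk => sum_eq_sum_Ico_succ_bot hk a
  -- the key inequality `|u_k| ≤ 2ⁿ + ½ R (k+1)` from the `k`-th Gram–Schmidt coordinate of `ū`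
  have key : ∀ k (hk : k < n), a k ≤ 2 ^ n + 1 / 2 * R (k + 1) := by
    intro k hk
    set kk : Fin n := ⟨k, hk⟩ with hkk
    have hne : gramSchmidt ℝ b kk ≠ 0 := gramSchmidt_ne_zero kk hb
    have hsq : 0 < ‖gramSchmidt ℝ b kk‖ ^ 2 := pow_pos (norm_pos_iff.2 hne) 2
    -- `c j = uⱼ ⟪bⱼ, b*_k⟫`, extended by `0`
    set c : ℕ → ℝ := fun j =>
      if hj : j < n then (u ⟨j, hj⟩ : ℝ) * ⟪b ⟨j, hj⟩, gramSchmidt ℝ b kk⟫_ℝ else 0 with hc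
    have F1 : ⟪∑ j, (u j : ℝ) • b j, gramSchmidt ℝ b kk⟫_ℝ = ∑ j ∈ range n, c j := by
      rw [sum_inner, ← Fin.sum_univ_eq_sum_range (fun j => c j) n]
      refine Finset.sum_congr rfl fun j _ => ?_
      rw [real_inner_smul_left]
      simp only [hc, dif_pos j.isLt, Fin.eta]
    have F3 : ∑ j ∈ Ico 0 k, c j = 0 := by
      refine Finset.sum_eq_zero fun j hj => ?_
      have hjk : j < k := (mem_Ico.1 hj).2
      have hjn : j < n := hjk.trans hk
      simp only [hc, dif_pos hjn]
      rw [real_inner_comm,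
        gramSchmidt_inv_triangular ℝ b (show (⟨j, hjn⟩ : Fin n) < kk from hjk), mul_zero]
    have F4 : c k = (u kk : ℝ) * ‖gramSchmidt ℝ b kk‖ ^ 2 := by
      simp only [hc, dif_pos hk]
      rw [inner_self_gramSchmidt]
    have F2 : ∑ j ∈ range n, c j =
        (u kk : ℝ) * ‖gramSchmidt ℝ b kk‖ ^ 2 + ∑ j ∈ Ico (k + 1) n, c j := by
      rw [range_eq_Ico, ← sum_Ico_consecutive c (Nat.zero_le k) hk.le, F3, zero_add,
        sum_eq_sum_Ico_succ_bot hk, F4]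
    have F5 : |∑ j ∈ Ico (k + 1) n, c j| ≤ 1 / 2 * ‖gramSchmidt ℝ b kk‖ ^ 2 * R (k + 1) := by
      calc |∑ j ∈ Ico (k + 1) n, c j| ≤ ∑ j ∈ Ico (k + 1) n, |c j| := abs_sum_le_sum_abs _ _
        _ ≤ ∑ j ∈ Ico (k + 1) n, 1 / 2 * ‖gramSchmidt ℝ b kk‖ ^ 2 * a j := by
            refine sum_le_sum fun j hj => ?_
            have hkj : k < j := (mem_Ico.1 hj).1
            have hjn : j < n := (mem_Ico.1 hj).2
            simp only [hc, ha, dif_pos hjn, abs_mul]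
            have hin := abs_inner_gramSchmidt_le_half_sq_norm h (show kk < ⟨j, hjn⟩ from hkj)
            calc |(u ⟨j, hjn⟩ : ℝ)| * |⟪b ⟨j, hjn⟩, gramSchmidt ℝ b kk⟫_ℝ|
                ≤ |(u ⟨j, hjn⟩ : ℝ)| * (1 / 2 * ‖gramSchmidt ℝ b kk‖ ^ 2) :=
                  mul_le_mul_of_nonneg_left hin (abs_nonneg _)
              _ = 1 / 2 * ‖gramSchmidt ℝ b kk‖ ^ 2 * |(u ⟨j, hjn⟩ : ℝ)| := by ring
        _ = 1 / 2 * ‖gramSchmidt ℝ b kk‖ ^ 2 * R (k + 1) := by rw [hR, Finset.mul_sum]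
    have F6 : |⟪∑ j, (u j : ℝ) • b j, gramSchmidt ℝ b kk⟫_ℝ| ≤ 2 ^ n * ‖gramSchmidt ℝ b kk‖ ^ 2 :=
      calc |⟪∑ j, (u j : ℝ) • b j, gramSchmidt ℝ b kk⟫_ℝ|
          ≤ ‖∑ j, (u j : ℝ) • b j‖ * ‖gramSchmidt ℝ b kk‖ := abs_real_inner_le_norm _ _
        _ ≤ ‖b ⟨0, hn⟩‖ * ‖gramSchmidt ℝ b kk‖ := mul_le_mul_of_nonneg_right hu (norm_nonneg _)
        _ ≤ (2 ^ n * ‖gramSchmidt ℝ b kk‖) * ‖gramSchmidt ℝ b kk‖ :=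
            mul_le_mul_of_nonneg_right (norm_zero_le_two_pow_mul_norm_gramSchmidt h hn kk)
              (norm_nonneg _)
        _ = 2 ^ n * ‖gramSchmidt ℝ b kk‖ ^ 2 := by ring
    -- combine
    have hck : (u kk : ℝ) * ‖gramSchmidt ℝ b kk‖ ^ 2 =
        ⟪∑ j, (u j : ℝ) • b j, gramSchmidt ℝ b kk⟫_ℝ - ∑ j ∈ Ico (k + 1) n, c j := by
      rw [F1, F2]
      ring
    have habs : |(u kk : ℝ)| * ‖gramSchmidt ℝ b kk‖ ^ 2 ≤
        (2 ^ n + 1 / 2 * R (k + 1)) * ‖gramSchmidt ℝ b kk‖ ^ 2 :=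
      calc |(u kk : ℝ)| * ‖gramSchmidt ℝ b kk‖ ^ 2 = |(u kk : ℝ) * ‖gramSchmidt ℝ b kk‖ ^ 2| := by
            rw [abs_mul, abs_of_nonneg (sq_nonneg ‖gramSchmidt ℝ b kk‖)]
        _ = |⟪∑ j, (u j : ℝ) • b j, gramSchmidt ℝ b kk⟫_ℝ - ∑ j ∈ Ico (k + 1) n, c j| := by
            rw [hck]
        _ ≤ |⟪∑ j, (u j : ℝ) • b j, gramSchmidt ℝ b kk⟫_ℝ| + |∑ j ∈ Ico (k + 1) n, c j| :=
            abs_sub _ _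
        _ ≤ 2 ^ n * ‖gramSchmidt ℝ b kk‖ ^ 2 + 1 / 2 * ‖gramSchmidt ℝ b kk‖ ^ 2 * R (k + 1) :=
            add_le_add F6 F5
        _ = (2 ^ n + 1 / 2 * R (k + 1)) * ‖gramSchmidt ℝ b kk‖ ^ 2 := by ring
    have hak : a k = |(u kk : ℝ)| := by simp only [ha, dif_pos hk, hkk]
    rw [hak]
    exact le_of_mul_le_mul_right habs hsq
  -- downward induction on the suffix sums: `R (n - d) ≤ 2^{n+d} - 2ⁿ`
  have hind : ∀ d, d ≤ n → R (n - d) ≤ 2 ^ (n + d) - 2 ^ n := by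
    intro d
    induction d with
    | zero =>
      intro _
      simp [hRn]
    | succ d ih =>
      intro hd
      have hk : n - (d + 1) < n := by omega
      have hk1 : n - (d + 1) + 1 = n - d := by omega
      have h1 := hRsucc _ hk
      have h2 := key _ hk
      rw [hk1] at h1 h2
      have h3 := ih (by omega)
      have hpow : (2 : ℝ) ^ (n + (d + 1)) = 2 * 2 ^ (n + d) := by ring
      have hmono : (2 : ℝ) ^ n ≤ 2 ^ (n + d) := pow_le_pow_right₀ (by norm_num) (by omega)
      rw [h1, hpow]
      nlinarith [hR0 (n - d)]
  -- conclusion for the index `i`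
  have hi : (i : ℕ) < n := i.isLt
  have h1 : a i ≤ R i := by
    rw [hRsucc i hi]
    linarith [hR0 ((i : ℕ) + 1)]
  have h2 : R i ≤ 2 ^ (n + (n - i)) - 2 ^ n := by
    have := hind (n - i) (Nat.sub_le _ _)
    rwa [Nat.sub_sub_self hi.le] at this
  have h3 : (2 : ℝ) ^ (n + (n - i)) ≤ 2 ^ (2 * n) := pow_le_pow_right₀ (by norm_num) (by omega)
  have hai : a i = |(u i : ℝ)| := by simp only [ha, dif_pos hi, Fin.eta]
  have h4 : (0 : ℝ) ≤ 2 ^ n := by positivity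
  linarith

end Abstract

/-- **Regev 2004, Lemma 3.3** (as printed, for integer bases). Let `B ∈ ℤⁿˣⁿ` be nonsingular with
rows `b₀, …, bₙ₋₁` forming an LLL-reduced basis (`δ = 3/4`) of `L(B)`, and let `u ∈ ℤⁿ` be the
coefficient vector of a shortest nonzero vector `ū = ∑ᵢ uᵢ bᵢ` of `L(B)` (`‖ū‖ = λ₁(L(B))`). Then
`|uᵢ| ≤ 2^{2n}` for every `i`. (From the abstract form: `λ₁ ≤ ‖b₀‖` as `b₀` is a nonzero lattice
vector.) [cite: Regev2004, Lemma 3.3] -/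
theorem Regev2004.abs_coeff_le_of_norm_eq_minNorm {I : LatticeInstance} (hI : I.IsNonsingular)
    (hred : IsLLLReduced (3 / 4) I.vec) (hn : 0 < I.n) {u : Fin I.n → ℤ}
    (hu : ‖I.ofCoeffs u‖ = minNorm I.lattice) (i : Fin I.n) : |u i| ≤ 2 ^ (2 * I.n) := by
  have hli : LinearIndependent ℝ I.vec := LatticeInstance.linearIndependent_vec hI
  have hb0 : I.vec ⟨0, hn⟩ ≠ 0 := hli.ne_zero _
  have hmin : minNorm I.lattice ≤ ‖I.vec ⟨0, hn⟩‖ :=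
    csInf_le ⟨0, by rintro _ ⟨x, -, rfl⟩; exact norm_nonneg x⟩
      ⟨_, ⟨Submodule.subset_span ⟨_, rfl⟩, hb0⟩, rfl⟩
  have hsum : I.ofCoeffs u = ∑ j, (u j : ℝ) • I.vec j := by
    rw [I.ofCoeffs_eq_sum]
    simp only [Int.cast_smul_eq_zsmul]
  have key := Regev2004.abs_coeff_le_two_pow_sq hli hred hn u (by rw [← hsum, hu]; exact hmin) i
  exact_mod_cast key

end Literature.Algebra.EuclideanLattices

end
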